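import Summits.HodgeConjecture.CorCM.GaloisBalancedCertificateLift
import Summits.HodgeConjecture.CorCM.Census.IndexTwoCyclicQuaternion
import Mathlib.GroupTheory.SpecificGroups.Quaternion
import HarnessLib

/-!
# `Q₈ × C_p ↪ Gal(K/ℚ)` (`p = 3, 5, 11`) or `Q₁₆ × C₇ ↪ Gal(K/ℚ)` THROUGH COMPLEX CONJUGATION, WITH `C_p` NORMAL, MAKES `K` BAD

COR-CM (cell `pub-hodgecm2`), binder seat b04 (gen 39), count-neutral own lane «Galois-CM-type classification».  KERNEL ONLY:
theorems; no definition, no named fact, no `sorry`.  `HC_CM` is neither used nor claimed.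

The tree's balanced-set certificates for `Q₈ × C₃` (gen 20, `CorCM/GaloisTwentyFourDegenerateModels`), `Q₈ × C₅`, `Q₈ × C₁₁`
(gen 24, `CorCM/GaloisQuaternionCyclic{Five,Eleven}Degenerate`) and `Q₁₆ × C₇` (gen 39, `CorCM/GaloisQuaternionSixteenCyclicSevenDegenerate`)
are BALANCED OVER `C_p` (the multiset of first coordinates of `D` is invariant under `c = (a^{m}, 1)`; checked by `decide` — it is
automatic, see `CorCM/GaloisBalancedCertificateLift`), so gen 39's lift `exists_simple_degenerate_of_subgroup_certificate` applies to
ANY Galois CM field whose Galois group contains elements `A, X, u` with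

  `ord A = 2m`, `X² = Aᵐ = c` (complex conjugation), `X A X⁻¹ = A⁻¹`, `ord u = p`, `[A,u] = [X,u] = 1`, `⟨u⟩ ◁ Gal(K/ℚ)`

(`⟨A, X⟩ × ⟨u⟩ ≅ Q_{4m} × C_p` embedded through `c`, `m ≥ 2`, `gcd(4m, p) = 1`): such `K` carries a SIMPLE DEGENERATE CM abelian
variety of dimension `[K:ℚ]/2` with an exceptional Hodge class on some power.  In particular (gen 38's five shapes,
`CorCM/GaloisOddPrimeShapes`): the shapes Q× = `Q_{2ⁿ} × C_p` (all `n ≥ 3`) and QK (all `n ≥ 4`) are BAD for `p ∈ {3, 5, 11}`, and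
Q× (`n ≥ 4`), QK (`n ≥ 5`) are BAD for `p = 7` — `CorCM/GaloisOddPrimeShapesQuaternionBad`.

* §1 `exists_injective_hom_quaternion_prod_cyclic` — the embedding `Q_{4m} × C_p →* G` of a commuting pair (quaternion
  presentation `A, X` via `Census.IndexTwoCyclic.quaternionHom`, and `u`), injective when `gcd(4m, p) = 1`, `m ≥ 2`.
* §2 **`exists_simple_degenerate_of_quaternion_cyclic_certificate`** — a balanced certificate on `Q_{4m} × C_p`, balanced over
  `C_p`, + such `A, X, u ∈ Gal(K/ℚ)` with `Aᵐ = c`, `⟨u⟩` normal ⟹ BAD.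
* §3 the four instances **`exists_simple_degenerate_of_quaternionEight_cyclic{Three,Five,Eleven}_subgroup`**,
  **`exists_simple_degenerate_of_quaternionSixteen_cyclicSeven_subgroup`**.

## References

* [Shimura1998] G. Shimura, *Abelian Varieties with Complex Multiplication and Modular Functions*, §6.2 Thm. 3, §8.2 Prop. 26.
* [Gordon1999HodgeAVSurvey] B. B. Gordon, *A survey of the Hodge conjecture for abelian varieties*, Thm. 6.4, §9.3.
* [Dodson1984] B. Dodson, *The structure of Galois groups of CM-fields*, Trans. AMS 283 (1984), §3.1.1, §5.3.
-/

noncomputable section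

open CategoryTheory CategoryTheory.Limits NumberField
open scoped BigOperators

namespace Summit.HodgeConjecture.CorCM.GaloisModels

open Literature.NumberTheory.ComplexMultiplication
open Literature.AlgebraicGeometry.Motives (AbelianVariety CMType)
open Literature.AlgebraicGeometry.HodgeTheory
open Literature.AlgebraicGeometry.ComplexMultiplication (IsCMTypeRealisation)
open Literature.AlgebraicGeometry.Pohlmann1968
open Literature.Barriers.HodgeConjecture (divisorClassesSpan)
open Summit.HodgeConjecture.CorCM.GaloisRank
open Summit.HodgeConjecture.CorCM.Census.IndexTwoCyclic (quaternionHom quaternionMap)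
open QuaternionGroup

/-! ## §1 The embedding `Q_{4m} × C_p →* G` of a quaternion presentation commuting with an element of order `p` -/

section Hom

variable {G : Type*} [Group G]

/-- **`Q_{4m} × C_p ↪ G`.**  `ord A = 2m`, `X² = Aᵐ`, `X A X⁻¹ = A⁻¹`, `ord u = p`, `[A,u] = [X,u] = 1`, `m ≥ 2`,
`gcd(4m, p) = 1` ⟹ an INJECTIVE homomorphism `ι : Q_{4m} × C_p →* G` with `ι(aⁱ, 1) = Aⁱ`, `ι(x aⁱ, 1) = X Aⁱ`,
`ι(1, j) = uʲ`, `ι(q, j) = ι(q, 1)·uʲ`. [folklore] -/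
theorem exists_injective_hom_quaternion_prod_cyclic [Finite G] {m p : ℕ} [NeZero m] [NeZero p] (hm : 2 ≤ m)
    (hcop : Nat.Coprime (4 * m) p) {A X u : G} (hA : orderOf A = 2 * m) (hX : X * X = A ^ m)
    (hXA : X * A * X⁻¹ = A⁻¹) (hu : orderOf u = p) (hAu : A * u = u * A) (hXu : X * u = u * X) :
    ∃ ι : QuaternionGroup m × Multiplicative (ZMod p) →* G, Function.Injective ι ∧
      (∀ i : ZMod (2 * m), ι (a i, 1) = A ^ i.val) ∧ (∀ i : ZMod (2 * m), ι (xa i, 1) = X * A ^ i.val) ∧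
      (∀ j : ZMod p, ι (1, Multiplicative.ofAdd j) = u ^ j.val) ∧
      ∀ (q : QuaternionGroup m) (j : Multiplicative (ZMod p)), ι (q, j) = ι (q, 1) * u ^ (Multiplicative.toAdd j).val := by
  classical
  -- the quaternion factor
  let φ : QuaternionGroup m →* G := quaternionHom hA hX hXA
  have hφa : ∀ i : ZMod (2 * m), φ (a i) = A ^ i.val := fun i => rfl
  have hφxa : ∀ i : ZMod (2 * m), φ (xa i) = X * A ^ i.val := fun i => rfl
  -- the cyclic factor
  have hmul : ∀ i j : ZMod p, u ^ (i + j).val = u ^ i.val * u ^ j.val := fun i j => by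
    rw [ZMod.val_add, ← pow_add, ← pow_mod_orderOf u (i.val + j.val), hu]
  let ψ : Multiplicative (ZMod p) →* G :=
    MonoidHom.mk' (fun j => u ^ (Multiplicative.toAdd j).val) fun i j => by
      simp only [toAdd_mul]
      exact hmul _ _
  have hψ : ∀ j : Multiplicative (ZMod p), ψ j = u ^ (Multiplicative.toAdd j).val := fun j => rfl
  -- they commute
  have hcommA : Commute A u := hAu
  have hcommX : Commute X u := hXu
  have hcomm : ∀ (q : QuaternionGroup m) (j : Multiplicative (ZMod p)), Commute (φ q) (ψ j) := by
    intro q j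
    rw [hψ]
    refine Commute.pow_right ?_ _
    cases q with
    | a i => rw [hφa]; exact hcommA.pow_left _
    | xa i => rw [hφxa]; exact (hcommX.mul_left (hcommA.pow_left _))
  let ι : QuaternionGroup m × Multiplicative (ZMod p) →* G := MonoidHom.noncommCoprod φ ψ hcomm
  have hι : ∀ q j, ι (q, j) = φ q * ψ j := fun q j => rfl
  -- `φ` is injective (`m ≥ 2`)
  have hφinj : ∀ q : QuaternionGroup m, φ q = 1 → q = 1 := by
    intro q hq
    cases q with
    | a i =>
      rw [hφa] at hq
      have hdvd : 2 * m ∣ i.val := by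
        have := orderOf_dvd_of_pow_eq_one hq
        rwa [hA] at this
      have hlt : i.val < 2 * m := i.val_lt
      have hi0 : i.val = 0 := by
        rcases hdvd with ⟨k, hk⟩
        rcases k with _ | k
        · simpa using hk
        · nlinarith [hk, hlt]
      have : i = 0 := (ZMod.val_eq_zero i).mp hi0
      rw [this]
      rfl
    | xa i =>
      exfalso
      rw [hφxa] at hq
      -- `X ∈ ⟨A⟩` forces `A = A⁻¹`, i.e. `A² = 1`, contradicting `ord A = 2m ≥ 4`
      have hXeq : X = (A ^ i.val)⁻¹ := eq_inv_of_mul_eq_one_left hq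
      have hAX : X * A * X⁻¹ = A := by
        rw [hXeq, inv_inv]
        group
      rw [hAX] at hXA
      have hA2 : A ^ 2 = 1 := by
        rw [pow_two]
        nth_rewrite 2 [hXA]
        exact mul_inv_cancel A
      have hdvd : 2 * m ∣ 2 := by rw [← hA]; exact orderOf_dvd_of_pow_eq_one hA2
      have := Nat.le_of_dvd (by norm_num) hdvd
      omega
  refine ⟨ι, ?_, fun i => ?_, fun i => ?_, fun j => ?_, fun q j => ?_⟩
  · -- injectivity: the two factors have coprime orders
    intro x y hxy
    rw [← inv_mul_eq_one]
    apply_fun (fun g => (ι x)⁻¹ * g) at hxy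
    rw [inv_mul_cancel, ← map_inv, ← map_mul] at hxy
    -- `hxy : 1 = ι (x⁻¹ * y)`
    set z := x⁻¹ * y with hz
    obtain ⟨q, j⟩ := z
    rw [hι] at hxy
    have hφq : φ q = (ψ j)⁻¹ := eq_inv_of_mul_eq_one_left hxy.symm
    -- order of `φ q` divides `4m` and `p`
    have h1 : orderOf (φ q) ∣ 4 * m := by
      have := orderOf_map_dvd φ q
      refine this.trans ?_
      have hcard : Nat.card (QuaternionGroup m) = 4 * m := by
        rw [Nat.card_eq_fintype_card, QuaternionGroup.card]
      rw [← hcard]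
      exact orderOf_dvd_natCard q
    have h2 : orderOf (φ q) ∣ p := by
      rw [hφq, orderOf_inv, hψ]
      exact (orderOf_pow_dvd _).trans (dvd_of_eq hu)
    have hone : orderOf (φ q) = 1 := Nat.Coprime.eq_one_of_dvd (Nat.Coprime.coprime_dvd_left h1 hcop) h2
    have hφq1 : φ q = 1 := orderOf_eq_one_iff.mp hone
    have hq1 : q = 1 := hφinj q hφq1
    have hψj : ψ j = 1 := by
      rw [hφq1] at hφq
      exact inv_eq_one.mp hφq.symm
    have hj1 : j = 1 := by
      rw [hψ] at hψj
      have hdvd : p ∣ (Multiplicative.toAdd j).val := by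
        have := orderOf_dvd_of_pow_eq_one hψj
        rwa [hu] at this
      have hlt : (Multiplicative.toAdd j).val < p := (Multiplicative.toAdd j).val_lt
      have h0 : (Multiplicative.toAdd j).val = 0 := Nat.eq_zero_of_dvd_of_lt hdvd hlt
      have : Multiplicative.toAdd j = 0 := (ZMod.val_eq_zero _).mp h0
      exact toAdd_eq_zero.mp this
    rw [hq1, hj1]
    rfl
  · rw [hι, hφa, map_one, mul_one]
  · rw [hι, hφxa, map_one, mul_one]
  · rw [hι, map_one, one_mul, hψ]
    rfl
  · rw [hι, hι, map_one, mul_one, hψ]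

end Hom

/-! ## §2 A balanced certificate on `Q_{4m} × C_p`, balanced over `C_p`, lifts along any such embedding -/

variable {K : Type} [Field K] [NumberField K] [IsCMField K]

/-- **`Q_{4m} × C_p ↪ Gal(K/ℚ)` THROUGH COMPLEX CONJUGATION WITH `C_p` NORMAL + A BALANCED CERTIFICATE ON `Q_{4m} × C_p`
BALANCED OVER `C_p` ⟹ BAD.**  `A, X, u ∈ Gal(K/ℚ)`: `ord A = 2m`, `X² = Aᵐ = c`, `X A X⁻¹ = A⁻¹`, `ord u = p`,
`[A,u] = [X,u] = 1`, `⟨u⟩ ◁ Gal(K/ℚ)` (`m ≥ 2`, `p` odd, `gcd(4m,p) = 1`); `T₁ ⊆ Q_{4m} × C_p` a CM set for `(aᵐ, 1)` with trivial left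
stabiliser, `D₁` balanced for `T₁`, moved by `(aᵐ,1)`, with `c`-invariant multiset of first coordinates.  Then `K` carries a simple
DEGENERATE CM abelian variety of dimension `[K:ℚ]/2` with a rational `(p,p)` class outside the divisor ring on some power.
[cite: Shimura1998, §6.2 Thm. 3 and §8.2 Prop. 26] [cite: Gordon1999HodgeAVSurvey, Thm. 6.4 and §9.3] -/
theorem exists_simple_degenerate_of_quaternion_cyclic_certificate [IsGalois ℚ K] {m p : ℕ} [NeZero m] [NeZero p]
    (hm : 2 ≤ m) (hp : Odd p) (hp1 : p ≠ 1) (hcop : Nat.Coprime (4 * m) p) {A X u : K ≃ₐ[ℚ] K} (hA : orderOf A = 2 * m)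
    (hX : X * X = A ^ m) (hXA : X * A * X⁻¹ = A⁻¹) (hc : A ^ m = (IsCMField.complexConj K).restrictScalars ℚ)
    (hu : orderOf u = p) (hAu : A * u = u * A) (hXu : X * u = u * X) (hnorm : (Subgroup.zpowers u).Normal)
    (T₁ : Finset (QuaternionGroup m × Multiplicative (ZMod p)))
    (hcm₁ : ∀ x, x ∈ T₁ ↔ ((a m, 1) : QuaternionGroup m × Multiplicative (ZMod p)) * x ∉ T₁)
    (hprim₁ : ∀ v : QuaternionGroup m × Multiplicative (ZMod p), v ≠ 1 → ∃ w, ¬ (w ∈ T₁ ↔ v * w ∈ T₁))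
    (D₁ : Finset (QuaternionGroup m × Multiplicative (ZMod p)))
    (hbal₁ : ∀ g : QuaternionGroup m × Multiplicative (ZMod p), 2 * (D₁.filter fun x => x * g ∈ T₁).card = D₁.card)
    (hmov₁ : ∃ x ∈ D₁, ((a m, 1) : QuaternionGroup m × Multiplicative (ZMod p)) * x ∉ D₁)
    (hsym₁ : D₁.val.map Prod.fst =
      (D₁.val.map fun x => ((a m, 1) : QuaternionGroup m × Multiplicative (ZMod p)) * x).map Prod.fst) :
    ∃ (Φ : CMType K) (φ₀ : K →+* ℂ) (A : AbelianVariety ℂ) (ι : 𝓞 K →+* End A)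
      (θ : K →+* Module.End ℂ (complexBetti A.X 1)),
      IsPrimitive (ℂ ≃+* ℂ) Φ.1 φ₀ ∧ ¬ IsNondegenerate Φ ∧ IsCMTypeRealisation Φ A ι θ ∧ A.IsSimple ∧
      A.dim = Module.finrank ℚ K / 2 ∧
      ∃ n p : ℕ, ∃ x : complexBetti (⨁ fun _ : Fin n => A).X (2 * p), IsRationalClass x ∧
        IsOfHodgeType (⨁ fun _ : Fin n => A).dim (⨁ fun _ : Fin n => A).X (2 * p) p p x ∧
        x ∉ divisorClassesSpan (⨁ fun _ : Fin n => A).X (⨁ fun _ : Fin n => A).dim p := by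
  classical
  obtain ⟨ι, hιinj, hιa, hιxa, hιu, hιq⟩ :=
    exists_injective_hom_quaternion_prod_cyclic hm hcop hA hX hXA hu hAu hXu
  -- `ι (aᵐ, 1) = Aᵐ = c`
  have hmval : ((m : ℕ) : ZMod (2 * m)).val = m := by
    rw [ZMod.val_natCast]
    exact Nat.mod_eq_of_lt (by have := NeZero.ne m; omega)
  have hιc : ι (a m, 1) = (IsCMField.complexConj K).restrictScalars ℚ := by rw [hιa, hmval, hc]
  -- powers of `u` are in the range
  have hurange : ∀ k : ℕ, u ^ k = ι (1, Multiplicative.ofAdd (k : ZMod p)) := fun k => by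
    rw [hιu, ZMod.val_natCast, ← hu, pow_mod_orderOf]
  have hNι : ∀ n ∈ Subgroup.zpowers u, n ∈ Set.range ι := by
    intro n hn
    obtain ⟨k, rfl⟩ := ((isOfFinOrder_of_finite u).mem_powers_iff_mem_zpowers.mpr hn)
    exact ⟨_, (hurange k).symm⟩
  -- `c ∉ ⟨u⟩` (`p` odd)
  have hcN : (IsCMField.complexConj K).restrictScalars ℚ ∉ Subgroup.zpowers u := by
    intro hmem
    obtain ⟨k, hk⟩ := ((isOfFinOrder_of_finite u).mem_powers_iff_mem_zpowers.mpr hmem)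
    have hcp : ((IsCMField.complexConj K).restrictScalars ℚ) ^ p = 1 := by
      rw [← hk, ← pow_mul, mul_comm, pow_mul, ← hu, pow_orderOf_eq_one, one_pow]
    obtain ⟨r, hr⟩ := id hp
    have hcc : ((IsCMField.complexConj K).restrictScalars ℚ) ^ 2 = 1 := by
      rw [pow_two]; exact GaloisOctic.complexConj_mul_self
    rw [hr, pow_succ, pow_mul, hcc, one_pow, one_mul] at hcp
    exact model_complexConj_ne_one (MulEquiv.refl _) rfl hcp
  have hN1 : Subgroup.zpowers u ≠ ⊥ := by
    rw [Ne, Subgroup.zpowers_eq_bot]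
    intro h1
    rw [h1, orderOf_one] at hu
    exact hp1 hu.symm
  have hπ : ∀ x y : QuaternionGroup m × Multiplicative (ZMod p), x.1 = y.1 → ι (x⁻¹ * y) ∈ Subgroup.zpowers u := by
    intro x y hxy
    have : x⁻¹ * y = ((1 : QuaternionGroup m), x.2⁻¹ * y.2) := by
      ext
      · simp [hxy]
      · rfl
    rw [this, hιq, ← Prod.one_eq_mk, map_one, one_mul]
    exact Subgroup.pow_mem _ (Subgroup.mem_zpowers u) _
  exact exists_simple_degenerate_of_subgroup_certificate ι hιinj (a m, 1) hιc (Subgroup.zpowers u) hNι hcN hN1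
    Prod.fst hπ T₁ hcm₁ hprim₁ D₁ hbal₁ hmov₁ hsym₁

/-! ## §3 The four instances -/

/-- **`Q₈ × C₃ ↪ Gal(K/ℚ)` through `c`, `C₃` normal ⟹ BAD**: `ord A = 4`, `X² = A² = c`, `XAX⁻¹ = A⁻¹`, `ord u = 3`,
`[A,u] = [X,u] = 1`, `⟨u⟩ ◁ Gal` (gen 20's certificate for `Q₈ × C₃`, balanced over `C₃`).
[cite: Shimura1998, §6.2 Thm. 3 and §8.2 Prop. 26] [cite: Gordon1999HodgeAVSurvey, Thm. 6.4] -/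
theorem exists_simple_degenerate_of_quaternionEight_cyclicThree_subgroup [IsGalois ℚ K] {A X u : K ≃ₐ[ℚ] K}
    (hA : orderOf A = 4) (hX : X * X = A ^ 2) (hXA : X * A * X⁻¹ = A⁻¹)
    (hc : A ^ 2 = (IsCMField.complexConj K).restrictScalars ℚ) (hu : orderOf u = 3) (hAu : A * u = u * A)
    (hXu : X * u = u * X) (hnorm : (Subgroup.zpowers u).Normal) :
    ∃ (Φ : CMType K) (φ₀ : K →+* ℂ) (A : AbelianVariety ℂ) (ι : 𝓞 K →+* End A)
      (θ : K →+* Module.End ℂ (complexBetti A.X 1)),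
      IsPrimitive (ℂ ≃+* ℂ) Φ.1 φ₀ ∧ ¬ IsNondegenerate Φ ∧ IsCMTypeRealisation Φ A ι θ ∧ A.IsSimple ∧
      A.dim = Module.finrank ℚ K / 2 ∧
      ∃ n p : ℕ, ∃ x : complexBetti (⨁ fun _ : Fin n => A).X (2 * p), IsRationalClass x ∧
        IsOfHodgeType (⨁ fun _ : Fin n => A).dim (⨁ fun _ : Fin n => A).X (2 * p) p p x ∧
        x ∉ divisorClassesSpan (⨁ fun _ : Fin n => A).X (⨁ fun _ : Fin n => A).dim p :=
  exists_simple_degenerate_of_quaternion_cyclic_certificate (m := 2) (p := 3) le_rfl (by decide) (by decide) (by decide)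
    hA hX hXA hc hu hAu hXu hnorm
    {(a 0, Multiplicative.ofAdd 0), (a 0, Multiplicative.ofAdd 1), (a 0, Multiplicative.ofAdd 2),
      (a 1, Multiplicative.ofAdd 0), (a 1, Multiplicative.ofAdd 1), (a 3, Multiplicative.ofAdd 2),
      (xa 0, Multiplicative.ofAdd 0), (xa 0, Multiplicative.ofAdd 2), (xa 1, Multiplicative.ofAdd 0),
      (xa 2, Multiplicative.ofAdd 1), (xa 3, Multiplicative.ofAdd 1), (xa 3, Multiplicative.ofAdd 2)}
    (by decide) (by decide)
    {(a 0, Multiplicative.ofAdd 0), (a 1, Multiplicative.ofAdd 0), (a 2, Multiplicative.ofAdd 1),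
      (a 3, Multiplicative.ofAdd 2), (xa 0, Multiplicative.ofAdd 1), (xa 2, Multiplicative.ofAdd 2)}
    (by decide) (by decide) (by decide)

set_option maxRecDepth 8000 in
/-- **`Q₈ × C₅ ↪ Gal(K/ℚ)` through `c`, `C₅` normal ⟹ BAD** (gen 24's certificate for `Q₈ × C₅`, balanced over `C₅`).
[cite: Shimura1998, §6.2 Thm. 3 and §8.2 Prop. 26] [cite: Gordon1999HodgeAVSurvey, Thm. 6.4] -/
theorem exists_simple_degenerate_of_quaternionEight_cyclicFive_subgroup [IsGalois ℚ K] {A X u : K ≃ₐ[ℚ] K}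
    (hA : orderOf A = 4) (hX : X * X = A ^ 2) (hXA : X * A * X⁻¹ = A⁻¹)
    (hc : A ^ 2 = (IsCMField.complexConj K).restrictScalars ℚ) (hu : orderOf u = 5) (hAu : A * u = u * A)
    (hXu : X * u = u * X) (hnorm : (Subgroup.zpowers u).Normal) :
    ∃ (Φ : CMType K) (φ₀ : K →+* ℂ) (A : AbelianVariety ℂ) (ι : 𝓞 K →+* End A)
      (θ : K →+* Module.End ℂ (complexBetti A.X 1)),
      IsPrimitive (ℂ ≃+* ℂ) Φ.1 φ₀ ∧ ¬ IsNondegenerate Φ ∧ IsCMTypeRealisation Φ A ι θ ∧ A.IsSimple ∧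
      A.dim = Module.finrank ℚ K / 2 ∧
      ∃ n p : ℕ, ∃ x : complexBetti (⨁ fun _ : Fin n => A).X (2 * p), IsRationalClass x ∧
        IsOfHodgeType (⨁ fun _ : Fin n => A).dim (⨁ fun _ : Fin n => A).X (2 * p) p p x ∧
        x ∉ divisorClassesSpan (⨁ fun _ : Fin n => A).X (⨁ fun _ : Fin n => A).dim p :=
  exists_simple_degenerate_of_quaternion_cyclic_certificate (m := 2) (p := 5) le_rfl (by decide) (by decide) (by decide)
    hA hX hXA hc hu hAu hXu hnorm
    {(a 0, Multiplicative.ofAdd 2), (a 0, Multiplicative.ofAdd 3), (a 0, Multiplicative.ofAdd 4),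
      (a 1, Multiplicative.ofAdd 0), (a 1, Multiplicative.ofAdd 1), (a 1, Multiplicative.ofAdd 2),
      (a 1, Multiplicative.ofAdd 3), (a 2, Multiplicative.ofAdd 0), (a 2, Multiplicative.ofAdd 1),
      (a 3, Multiplicative.ofAdd 4), (xa 0, Multiplicative.ofAdd 1), (xa 1, Multiplicative.ofAdd 0),
      (xa 1, Multiplicative.ofAdd 4), (xa 2, Multiplicative.ofAdd 0), (xa 2, Multiplicative.ofAdd 2),
      (xa 2, Multiplicative.ofAdd 3), (xa 2, Multiplicative.ofAdd 4), (xa 3, Multiplicative.ofAdd 1),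
      (xa 3, Multiplicative.ofAdd 2), (xa 3, Multiplicative.ofAdd 3)}
    (by decide) (by decide)
    {(a 0, Multiplicative.ofAdd 4), (a 1, Multiplicative.ofAdd 2), (a 1, Multiplicative.ofAdd 3),
      (a 2, Multiplicative.ofAdd 1), (a 3, Multiplicative.ofAdd 0), (a 3, Multiplicative.ofAdd 1),
      (xa 0, Multiplicative.ofAdd 0), (xa 0, Multiplicative.ofAdd 4), (xa 1, Multiplicative.ofAdd 3),
      (xa 2, Multiplicative.ofAdd 1), (xa 2, Multiplicative.ofAdd 2), (xa 3, Multiplicative.ofAdd 1)}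
    (by decide) (by decide) (by decide)

set_option maxRecDepth 8000 in
/-- **`Q₈ × C₁₁ ↪ Gal(K/ℚ)` through `c`, `C₁₁` normal ⟹ BAD** (gen 24's certificate for `Q₈ × C₁₁`, balanced over `C₁₁`).
[cite: Shimura1998, §6.2 Thm. 3 and §8.2 Prop. 26] [cite: Gordon1999HodgeAVSurvey, Thm. 6.4] -/
theorem exists_simple_degenerate_of_quaternionEight_cyclicEleven_subgroup [IsGalois ℚ K] {A X u : K ≃ₐ[ℚ] K}
    (hA : orderOf A = 4) (hX : X * X = A ^ 2) (hXA : X * A * X⁻¹ = A⁻¹)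
    (hc : A ^ 2 = (IsCMField.complexConj K).restrictScalars ℚ) (hu : orderOf u = 11) (hAu : A * u = u * A)
    (hXu : X * u = u * X) (hnorm : (Subgroup.zpowers u).Normal) :
    ∃ (Φ : CMType K) (φ₀ : K →+* ℂ) (A : AbelianVariety ℂ) (ι : 𝓞 K →+* End A)
      (θ : K →+* Module.End ℂ (complexBetti A.X 1)),
      IsPrimitive (ℂ ≃+* ℂ) Φ.1 φ₀ ∧ ¬ IsNondegenerate Φ ∧ IsCMTypeRealisation Φ A ι θ ∧ A.IsSimple ∧
      A.dim = Module.finrank ℚ K / 2 ∧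
      ∃ n p : ℕ, ∃ x : complexBetti (⨁ fun _ : Fin n => A).X (2 * p), IsRationalClass x ∧
        IsOfHodgeType (⨁ fun _ : Fin n => A).dim (⨁ fun _ : Fin n => A).X (2 * p) p p x ∧
        x ∉ divisorClassesSpan (⨁ fun _ : Fin n => A).X (⨁ fun _ : Fin n => A).dim p :=
  exists_simple_degenerate_of_quaternion_cyclic_certificate (m := 2) (p := 11) le_rfl (by decide) (by decide) (by decide)
    hA hX hXA hc hu hAu hXu hnorm
    {(a 0, Multiplicative.ofAdd 1), (a 0, Multiplicative.ofAdd 3), (a 0, Multiplicative.ofAdd 4),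
      (a 0, Multiplicative.ofAdd 5), (a 0, Multiplicative.ofAdd 6), (a 0, Multiplicative.ofAdd 7),
      (a 0, Multiplicative.ofAdd 8), (a 0, Multiplicative.ofAdd 9), (a 0, Multiplicative.ofAdd 10),
      (a 1, Multiplicative.ofAdd 0), (a 1, Multiplicative.ofAdd 2), (a 1, Multiplicative.ofAdd 3),
      (a 1, Multiplicative.ofAdd 4), (a 1, Multiplicative.ofAdd 5), (a 1, Multiplicative.ofAdd 6),
      (a 1, Multiplicative.ofAdd 7), (a 1, Multiplicative.ofAdd 8), (a 1, Multiplicative.ofAdd 9),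
      (a 1, Multiplicative.ofAdd 10), (a 2, Multiplicative.ofAdd 0), (a 2, Multiplicative.ofAdd 2),
      (a 3, Multiplicative.ofAdd 1), (xa 0, Multiplicative.ofAdd 1), (xa 0, Multiplicative.ofAdd 5),
      (xa 0, Multiplicative.ofAdd 7), (xa 0, Multiplicative.ofAdd 9), (xa 0, Multiplicative.ofAdd 10),
      (xa 1, Multiplicative.ofAdd 0), (xa 1, Multiplicative.ofAdd 2), (xa 1, Multiplicative.ofAdd 5),
      (xa 1, Multiplicative.ofAdd 7), (xa 1, Multiplicative.ofAdd 9), (xa 1, Multiplicative.ofAdd 10),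
      (xa 2, Multiplicative.ofAdd 0), (xa 2, Multiplicative.ofAdd 2), (xa 2, Multiplicative.ofAdd 3),
      (xa 2, Multiplicative.ofAdd 4), (xa 2, Multiplicative.ofAdd 6), (xa 2, Multiplicative.ofAdd 8),
      (xa 3, Multiplicative.ofAdd 1), (xa 3, Multiplicative.ofAdd 3), (xa 3, Multiplicative.ofAdd 4),
      (xa 3, Multiplicative.ofAdd 6), (xa 3, Multiplicative.ofAdd 8)}
    (by decide) (by decide)
    {(a 0, Multiplicative.ofAdd 0), (a 0, Multiplicative.ofAdd 6), (a 0, Multiplicative.ofAdd 7),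
      (a 1, Multiplicative.ofAdd 4), (a 1, Multiplicative.ofAdd 10), (a 2, Multiplicative.ofAdd 3),
      (a 2, Multiplicative.ofAdd 4), (a 2, Multiplicative.ofAdd 5), (a 3, Multiplicative.ofAdd 3),
      (a 3, Multiplicative.ofAdd 7), (xa 0, Multiplicative.ofAdd 5), (xa 0, Multiplicative.ofAdd 6),
      (xa 0, Multiplicative.ofAdd 10), (xa 1, Multiplicative.ofAdd 2), (xa 1, Multiplicative.ofAdd 9),
      (xa 2, Multiplicative.ofAdd 1), (xa 2, Multiplicative.ofAdd 2), (xa 2, Multiplicative.ofAdd 9),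
      (xa 3, Multiplicative.ofAdd 0), (xa 3, Multiplicative.ofAdd 1)}
    (by decide) (by decide) (by decide)

set_option maxRecDepth 16000 in
/-- **`Q₁₆ × C₇ ↪ Gal(K/ℚ)` through `c`, `C₇` normal ⟹ BAD**: `ord A = 8`, `X² = A⁴ = c`, `XAX⁻¹ = A⁻¹`, `ord u = 7`,
`[A,u] = [X,u] = 1`, `⟨u⟩ ◁ Gal` (gen 39's certificate for `Q₁₆ × C₇`, balanced over `C₇`; recall `Q₈ × C₇` is GOOD).
[cite: Shimura1998, §6.2 Thm. 3 and §8.2 Prop. 26] [cite: Gordon1999HodgeAVSurvey, Thm. 6.4] -/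
theorem exists_simple_degenerate_of_quaternionSixteen_cyclicSeven_subgroup [IsGalois ℚ K] {A X u : K ≃ₐ[ℚ] K}
    (hA : orderOf A = 8) (hX : X * X = A ^ 4) (hXA : X * A * X⁻¹ = A⁻¹)
    (hc : A ^ 4 = (IsCMField.complexConj K).restrictScalars ℚ) (hu : orderOf u = 7) (hAu : A * u = u * A)
    (hXu : X * u = u * X) (hnorm : (Subgroup.zpowers u).Normal) :
    ∃ (Φ : CMType K) (φ₀ : K →+* ℂ) (A : AbelianVariety ℂ) (ι : 𝓞 K →+* End A)
      (θ : K →+* Module.End ℂ (complexBetti A.X 1)),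
      IsPrimitive (ℂ ≃+* ℂ) Φ.1 φ₀ ∧ ¬ IsNondegenerate Φ ∧ IsCMTypeRealisation Φ A ι θ ∧ A.IsSimple ∧
      A.dim = Module.finrank ℚ K / 2 ∧
      ∃ n p : ℕ, ∃ x : complexBetti (⨁ fun _ : Fin n => A).X (2 * p), IsRationalClass x ∧
        IsOfHodgeType (⨁ fun _ : Fin n => A).dim (⨁ fun _ : Fin n => A).X (2 * p) p p x ∧
        x ∉ divisorClassesSpan (⨁ fun _ : Fin n => A).X (⨁ fun _ : Fin n => A).dim p :=
  exists_simple_degenerate_of_quaternion_cyclic_certificate (m := 4) (p := 7) (by norm_num) (by decide) (by decide) (by decide)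
    hA hX hXA hc hu hAu hXu hnorm
    {(a 0, Multiplicative.ofAdd 0), (a 1, Multiplicative.ofAdd 0), (a 1, Multiplicative.ofAdd 3),
      (a 1, Multiplicative.ofAdd 5), (a 1, Multiplicative.ofAdd 6), (a 2, Multiplicative.ofAdd 3),
      (a 2, Multiplicative.ofAdd 5), (a 2, Multiplicative.ofAdd 6), (a 3, Multiplicative.ofAdd 1),
      (a 3, Multiplicative.ofAdd 2), (a 3, Multiplicative.ofAdd 3), (a 3, Multiplicative.ofAdd 4),
      (a 3, Multiplicative.ofAdd 5), (a 3, Multiplicative.ofAdd 6), (a 4, Multiplicative.ofAdd 1),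
      (a 4, Multiplicative.ofAdd 2), (a 4, Multiplicative.ofAdd 3), (a 4, Multiplicative.ofAdd 4),
      (a 4, Multiplicative.ofAdd 5), (a 4, Multiplicative.ofAdd 6), (a 5, Multiplicative.ofAdd 1),
      (a 5, Multiplicative.ofAdd 2), (a 5, Multiplicative.ofAdd 4), (a 6, Multiplicative.ofAdd 0),
      (a 6, Multiplicative.ofAdd 1), (a 6, Multiplicative.ofAdd 2), (a 6, Multiplicative.ofAdd 4),
      (a 7, Multiplicative.ofAdd 0), (xa 0, Multiplicative.ofAdd 1), (xa 0, Multiplicative.ofAdd 2),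
      (xa 0, Multiplicative.ofAdd 3), (xa 0, Multiplicative.ofAdd 4), (xa 0, Multiplicative.ofAdd 5),
      (xa 0, Multiplicative.ofAdd 6), (xa 1, Multiplicative.ofAdd 0), (xa 1, Multiplicative.ofAdd 1),
      (xa 1, Multiplicative.ofAdd 2), (xa 1, Multiplicative.ofAdd 3), (xa 1, Multiplicative.ofAdd 4),
      (xa 1, Multiplicative.ofAdd 5), (xa 1, Multiplicative.ofAdd 6), (xa 2, Multiplicative.ofAdd 0),
      (xa 2, Multiplicative.ofAdd 1), (xa 2, Multiplicative.ofAdd 2), (xa 2, Multiplicative.ofAdd 3),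
      (xa 2, Multiplicative.ofAdd 4), (xa 2, Multiplicative.ofAdd 5), (xa 2, Multiplicative.ofAdd 6),
      (xa 3, Multiplicative.ofAdd 0), (xa 3, Multiplicative.ofAdd 1), (xa 3, Multiplicative.ofAdd 2),
      (xa 3, Multiplicative.ofAdd 3), (xa 3, Multiplicative.ofAdd 4), (xa 3, Multiplicative.ofAdd 5),
      (xa 3, Multiplicative.ofAdd 6), (xa 4, Multiplicative.ofAdd 0)}
    (by decide +kernel) (by decide +kernel)
    {(a 0, Multiplicative.ofAdd 0), (a 1, Multiplicative.ofAdd 0), (a 1, Multiplicative.ofAdd 4),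
      (a 2, Multiplicative.ofAdd 1), (a 2, Multiplicative.ofAdd 4), (a 3, Multiplicative.ofAdd 1),
      (a 4, Multiplicative.ofAdd 1), (a 5, Multiplicative.ofAdd 3), (a 5, Multiplicative.ofAdd 5),
      (a 6, Multiplicative.ofAdd 3), (a 6, Multiplicative.ofAdd 5), (a 7, Multiplicative.ofAdd 0),
      (xa 0, Multiplicative.ofAdd 1), (xa 4, Multiplicative.ofAdd 0)}
    (by decide +kernel) (by decide +kernel) (by decide +kernel)

end Summit.HodgeConjecture.CorCM.GaloisModels

end
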